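import Literature.AnabelianGeometry.EtaleTheta.DivisorMonoidsOfGaloisCovering

/-!
# [EtTh] Prop. 3.4 (ii) PROVED at the Def. 3.3 (iii) data of the coverings dominated by one universal
# combinatorial covering — "Assertion (ii) follows immediately from Proposition 3.2, (ii) [and the definitions]"

S. Mochizuki, *The étale theta function …*, Publ. RIMS **45** (2009) [MochizukiEtTh2009], §3, Prop. 3.4
"(Divisor and Rational Function Monoids)", statement PRIMS PDF p.74 (printed p.300) ll.49–68 of the cell's
render, proof p.75 ll.10–11 [cite: MochizukiEtTh2009, Prop 3.4 p.74]:

"(ii) Suppose that `Y^log → X^log` is a connected tempered covering such that the composite morphism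
`Y^log → Spec(K)` factors through `Spec(L)`, for some finite extension `L` of `K`, in such a way that `Y^log`
is geometrically connected over `L`.  Then we have natural isomorphisms of monoids
`O_L^× ⥲ Ker(B₀(Y^log) → Φ₀^gp(Y^log)) ⊆ B₀(Y^log)`; `O_L^▷ ⥲ B₀(Y^log) ×_{Φ₀^gp(Y^log)} Φ₀(Y^log)`;
`L^× ⥲ F₀(Y^log) ⊆ B₀(Y^log)` — where '`O_L^▷`' is as in [Mzk18], Example 1.1."
Proof (p.75): "Assertion (ii) follows immediately from Proposition 3.2, (ii) [and the definitions]."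

PROOF-ONLY companion (abc-iut cell, W6 row d058, node `EtTh:Prop3.4(ii)`; no `def`, no instance, no new
Prop fact).  WHAT IS PROVED, and at which data.  The typed node `DivisorMonoids.Prop34` (abc-iut-L2-t3,
`DivisorMonoids.lean`) renders (ii) by two one-sided CONSEQUENCES over ABSTRACT Def. 3.3 (iii) data `T`
(`ker_div₀_le_F₀`: "trivial divisor ⇒ constant", `mem_F₀_of_div₀_mem`: "effective divisor ⇒ constant") as
FIELDS of a hypothesis structure; the three isomorphisms themselves (with `O_L^×`, `O_L^▷`, `L^×`) have no
kernel statement there.  Here they are THEOREMS at the Def. 3.3 (iii) data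
`DivisorMonoids.ofGaloisAction A hZ` (`DivisorMonoidsOfGaloisCovering.lean`) CONSTRUCTED from the Def. 3.1 /
Prop. 3.2 interface `Z : LogDivisorModel` of ONE universal combinatorial covering `Z^log_∞` with its Galois
group `G = Gal(Z^log_∞/X^log)` acting (`A : Z.GaloisAction G`), over the `G`-sets `S` (the connected
covering `Y^log` of (ii) is the transitive `G`-set `S = G/H`, `H = Gal(Z^log_∞/Y^log)`), and they are
derived, as print says, from Prop. 3.2 (ii) BY NAME — the interface fields
`LogDivisorModel.divisor_eq_one_iff`, `mem_intConst_of_divisor_mem`, `divisor_mem_of_mem_intConst`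
("all regular functions on `Z_∞` are constant") — and the definitions:

* iso 1 — `divZeroHom_eq_one_iff`: `b ∈ B₀(S) = Hom_G(S, Mero(Z^log_∞))` has trivial log-divisor iff every
  value `b s` is a UNIT integral constant (`b s, (b s)⁻¹ ∈ O^▷`): `Ker(B₀(S) → Φ₀^gp(S)) = Hom_G(S, O^×)`;
* iso 2 — `exists_divZeroHom_eq_of_iff`: `div₀ b` is (the class of) an EFFECTIVE element of `Φ₀(S)` iff every
  value of `b` is an integral constant: `B₀(S) ×_{Φ₀^gp(S)} Φ₀(S) = Hom_G(S, O^▷)`; moreover that effective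
  divisor is then NON-CUSPIDAL (`ncsp_of_divZeroHom_eq_of`, the divisor of `π_L` is the special fibre);
* iso 3 — `GaloisAction.mem_fZero_iff` (landed, `DivisorMonoidsOfGaloisCovering.lean`): `F₀(S) = Hom_G(S, L^×)` by
  definition ("[and the definitions]"); here: a
  SUBGROUP of the group `B₀(S)` (`inv_mem_fZero`; the binder `hFinv` of GAP row G-w5d135-1 holds here by
  construction, `exists_inv_mem_fZero`).
For `S = G/H` the right-hand sides are the `H`-invariants `(O_{L'}^×)^H`, `(O_{L'}^▷)^H`, `(L'^×)^H` of the
constants `L'` of `Z^log_∞` (`eq_of_bZero_quotient`, `exists_bZero_quotient_of_invariant`: `B₀(G/H) =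
Mero(Z^log_∞)^H` ON THE NOSE, Def. 3.3 (iii)'s formula at this term of the limit; likewise
`exists_phiZero_quotient_of_invariant`: `Φ₀(G/H) = Div⁺(Z^log_∞)^H`): print's `O_L^×`, `O_L^▷`, `L^×` for the field of
constants `L = L'^H` of `Y^log` — the hypothesis "geometrically connected over `L`" is what identifies
`L'^H` with the `L` of the statement, and is the only part of (ii) not visible on the interface (the
interface carries `L'^× = const`, `O_{L'}^▷ = intConst` as submonoids of `Fn`, not the field).
* the typed fields — `prop34_ker_div₀_le_F₀`, `prop34_mem_F₀_of_div₀_mem` (via `O^▷ ⊆ L^×`,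
  `intConst_le_const`), hence `prop34_ofGaloisAction_iff`: at this data `DivisorMonoids.Prop34 V V₀` is
  EQUIVALENT to its three Prop. 3.4 (i) vocabulary clauses ((ii) carries no residual), and holds outright at
  the all-`True` vocabularies (`prop34_ofGaloisAction_top`).
HONEST FRAMING: theorems about a construction over typed interfaces (one term of Def. 3.3 (iii)'s inductive
limit; the limit over `Δ^fil`-closures is TODO-merge(abc-iut-L3-t2)); Prop. 3.2 (ii) enters as the
interface's hypothesis fields, exactly as print uses it; nothing here bears on [IUTchIII] Cor. 3.12; no side
is taken; typed ≠ proved for anything not stated here.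
-/

namespace Literature.AnabelianGeometry.EtaleTheta

open CategoryTheory Opposite Literature.AlgebraicGeometry.Frobenioids

universe u

namespace LogDivisorModel.GaloisAction

variable {Z : LogDivisorModel.{u}} {G : Type u} [Group G] (A : Z.GaloisAction G) (S : Action (Type u) G)

/-! ## Isomorphism 1: `O_L^× ⥲ Ker(B₀(Y) → Φ₀^gp(Y))` -/

/-- `div₀ b = 1` iff the divisor of every value `b s` is trivial. [cite: MochizukiEtTh2009, Prop 3.4 p.74] -/
theorem divZeroHom_eq_one_iff_divAt (b : A.bZero S) : A.divZeroHom S b = 1 ↔ ∀ s, A.divAt S b s = 1 := by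
  rw [← div_self' (Algebra.GrothendieckGroup.of (1 : A.phiZero S)), divZeroHom_eq_div_iff]
  refine forall_congr' fun s => ?_
  rw [OneMemClass.coe_one, Pi.one_apply, mul_one]

/-- **Prop. 3.4 (ii), isomorphism 1** (`O_L^× ⥲ Ker(B₀(Y^log) → Φ₀^gp(Y^log))`), at the Def. 3.3 (iii) data of
the coverings dominated by `Z^log_∞`: an equivariant log-meromorphic family `b ∈ B₀(S)` has trivial
log-divisor iff each value is a unit integral constant (`b s ∈ O^▷` and `(b s)⁻¹ ∈ O^▷`), i.e.
`Ker(div₀) = Hom_G(S, O^×)`.  From Prop. 3.2 (ii) (`LogDivisorModel.divisor_eq_one_iff`).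
[cite: MochizukiEtTh2009, Prop 3.4 p.74] -/
theorem divZeroHom_eq_one_iff (b : A.bZero S) :
    A.divZeroHom S b = 1 ↔ ∀ s, b.1 s ∈ Z.intConst ∧ (b.1 s)⁻¹ ∈ Z.intConst := by
  rw [divZeroHom_eq_one_iff_divAt]
  exact forall_congr' fun s => Z.divisor_eq_one_iff ⟨b.1 s, b.2.1 s⟩

/-! ## Isomorphism 2: `O_L^▷ ⥲ B₀(Y) ×_{Φ₀^gp(Y)} Φ₀(Y)` -/

/-- `div₀ b = [x]` for `x ∈ Φ₀(S)` iff `x` is, pointwise, the divisor of `b`. [cite: MochizukiEtTh2009, Prop 3.4 p.74] -/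
theorem divZeroHom_eq_of_iff (b : A.bZero S) (x : A.phiZero S) :
    A.divZeroHom S b = Algebra.GrothendieckGroup.of x ↔ ∀ s, A.divAt S b s = x.1 s := by
  rw [← div_one (Algebra.GrothendieckGroup.of x), ← map_one Algebra.GrothendieckGroup.of,
    divZeroHom_eq_div_iff]
  refine forall_congr' fun s => ?_
  rw [OneMemClass.coe_one, Pi.one_apply, mul_one]

/-- **Prop. 3.4 (ii), isomorphism 2** (`O_L^▷ ⥲ B₀(Y^log) ×_{Φ₀^gp(Y^log)} Φ₀(Y^log)`), at the Def. 3.3 (iii)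
data of the coverings dominated by `Z^log_∞`: the log-divisor of `b ∈ B₀(S)` is (the class of) an element
of `Φ₀(S)` — an EFFECTIVE Cartier log-divisor — iff each value of `b` is an integral constant (`∈ O^▷`), i.e.
the fibre product is `Hom_G(S, O^▷)`.  From Prop. 3.2 (ii) (`mem_intConst_of_divisor_mem`,
`divisor_mem_of_mem_intConst`) and "principal divisors are Cartier". [cite: MochizukiEtTh2009, Prop 3.4 p.74] -/
theorem exists_divZeroHom_eq_of_iff (b : A.bZero S) :
    (∃ x : A.phiZero S, A.divZeroHom S b = Algebra.GrothendieckGroup.of x) ↔ ∀ s, b.1 s ∈ Z.intConst := by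
  constructor
  · rintro ⟨x, hx⟩ s
    rw [divZeroHom_eq_of_iff] at hx
    exact Z.mem_intConst_of_divisor_mem ⟨b.1 s, b.2.1 s⟩ (by rw [← divAt, hx s]; exact (x.2.1 s).2)
  · intro h
    refine ⟨⟨fun s => A.divAt S b s,
      fun s => ⟨Z.divisor_mem_Div _, (Z.divisor_mem_of_mem_intConst _ (h s)).1⟩,
      fun g s => A.divAt_ρ S b g s⟩, ?_⟩
    rw [divZeroHom_eq_of_iff]
    intro s
    rfl

/-- … and then that effective log-divisor is NON-CUSPIDAL (supported in the special fibre: the divisor of a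
constant `∈ O^▷` is a multiple of the special fibre; Prop. 3.2 (ii), `divisor_mem_of_mem_intConst`).
[cite: MochizukiEtTh2009, Prop 3.4 p.74] -/
theorem ncsp_of_divZeroHom_eq_of (b : A.bZero S) (x : A.phiZero S)
    (hx : A.divZeroHom S b = Algebra.GrothendieckGroup.of x) : x ∈ A.ncspZero S := by
  have hint := (A.exists_divZeroHom_eq_of_iff S b).1 ⟨x, hx⟩
  rw [divZeroHom_eq_of_iff] at hx
  intro s
  rw [← hx s]
  exact (Z.divisor_mem_of_mem_intConst ⟨b.1 s, b.2.1 s⟩ (hint s)).2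

/-! ## Isomorphism 3: `L^× ⥲ F₀(Y)` -/

/-! **Prop. 3.4 (ii), isomorphism 3** (`L^× ⥲ F₀(Y^log) ⊆ B₀(Y^log)`): at the Def. 3.3 (iii) data of the
coverings dominated by `Z^log_∞`, `F₀(S) = Hom_G(S, L^×)` — the equivariant families of CONSTANT
log-meromorphic functions — holds BY DEFINITION, as in print ("[and the definitions]"): this is the landed
`GaloisAction.mem_fZero_iff` (`DivisorMonoidsOfGaloisCovering.lean`).  What is proved here is that `F₀(S)` is a
subgroup (`L^×` is a group). -/

/-- `F₀(S)` is inverse-closed: `L^×` is a group (isomorphism 3 of Prop. 3.4 (ii) makes `F₀(Y)` a group;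
membership itself is `GaloisAction.mem_fZero_iff`). [cite: MochizukiEtTh2009, Prop 3.4 p.74] -/
theorem inv_mem_fZero {b : A.bZero S} (hb : b ∈ A.fZero S) : b⁻¹ ∈ A.fZero S :=
  fun s => Z.const.inv_mem (hb s)

/-- The binder `hFinv` of GAP row G-w5d135-1 ("`F₀(Y) ⊆ B₀(Y)` is closed under inverses") HOLDS BY
CONSTRUCTION at this data. [cite: MochizukiEtTh2009, Prop 3.4 p.74] -/
theorem exists_inv_mem_fZero (b : A.bZero S) (hb : b ∈ A.fZero S) :
    ∃ b' ∈ A.fZero S, b' * b = 1 :=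
  ⟨b⁻¹, A.inv_mem_fZero S hb, inv_mul_cancel b⟩

/-- `Ker(div₀) ⊆ F₀(S)` (`O^× ⊆ L^×`) — the first typed consequence. [cite: MochizukiEtTh2009, Prop 3.4 p.74] -/
theorem mem_fZero_of_divZeroHom_eq_one {b : A.bZero S} (h : A.divZeroHom S b = 1) : b ∈ A.fZero S :=
  fun s => Z.intConst_le_const (((A.divZeroHom_eq_one_iff S b).1 h s).1)

/-- "effective divisor ⇒ constant" (`O^▷ ⊆ L^×`) — the second typed consequence. [cite: MochizukiEtTh2009, Prop 3.4 p.74] -/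
theorem mem_fZero_of_divZeroHom_eq_of {b : A.bZero S} {x : A.phiZero S}
    (h : A.divZeroHom S b = Algebra.GrothendieckGroup.of x) : b ∈ A.fZero S :=
  fun s => Z.intConst_le_const ((A.exists_divZeroHom_eq_of_iff S b).1 ⟨x, h⟩ s)

/-! ## The connected covering `Y^log ↔ S = G/H`: equivariant families are `H`-invariants -/

/-- For the transitive `G`-set `G/H` (the connected covering `Y^log` with `Gal(Z^log_∞/Y^log) = H`) an
equivariant family is determined by its value at the base point, which is `H`-INVARIANT: so `B₀(G/H)`,
`Ker(div₀)`, the effective locus and `F₀(G/H)` are `Mero(Z^log_∞)^H`, `(O^×)^H`, `(O^▷)^H`, `(L^×)^H` — print's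
`O_L^×`, `O_L^▷`, `L^×` for the constant field `L = L'^H` of `Y^log`. [cite: MochizukiEtTh2009, Prop 3.4 p.74] -/
theorem bZero_quotient_apply (H : Subgroup G) (b : A.bZero (Action.ofMulAction G (G ⧸ H))) (g : G) :
    b.1 (g : G ⧸ H) = A.actFn g (b.1 ((1 : G) : G ⧸ H)) := by
  have h := b.2.2 g ((1 : G) : G ⧸ H)
  rw [Action.ofMulAction_apply, MulAction.Quotient.smul_coe, smul_eq_mul, mul_one] at h
  exact h

/-- The value at the base point of an equivariant family on `G/H` is `H`-invariant.
[cite: MochizukiEtTh2009, Prop 3.4 p.74] -/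
theorem bZero_quotient_invariant (H : Subgroup G) (b : A.bZero (Action.ofMulAction G (G ⧸ H)))
    (h : G) (hh : h ∈ H) : A.actFn h (b.1 ((1 : G) : G ⧸ H)) = b.1 ((1 : G) : G ⧸ H) := by
  rw [← A.bZero_quotient_apply H b h]
  have e : ((h : G) : G ⧸ H) = ((1 : G) : G ⧸ H) :=
    QuotientGroup.eq.mpr (by rw [mul_one, inv_mem_iff]; exact hh)
  exact congrArg b.1 e

/-- Two equivariant families on `G/H` with the same value at the base point are equal
(`B₀(G/H) ↪ Mero(Z^log_∞)^H`). [cite: MochizukiEtTh2009, Prop 3.4 p.74] -/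
theorem eq_of_bZero_quotient (H : Subgroup G) (b c : A.bZero (Action.ofMulAction G (G ⧸ H)))
    (h : b.1 ((1 : G) : G ⧸ H) = c.1 ((1 : G) : G ⧸ H)) : b = c := by
  refine Subtype.ext (funext fun q => ?_)
  induction q using QuotientGroup.induction_on with
  | H g => rw [A.bZero_quotient_apply H b g, A.bZero_quotient_apply H c g, h]

/-- Conversely every `H`-INVARIANT log-meromorphic function is the base-point value of a (unique, by
`eq_of_bZero_quotient`) equivariant family on `G/H`: `B₀(G/H) = Mero(Z^log_∞)^H` on the nose — Def. 3.3
(iii)'s formula `B₀(Y^log) = Mero(Z^log_∞)^{Gal(Z^log_∞/Y^log)}` at this term of the limit.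
[cite: MochizukiEtTh2009, Def 3.3 p.73] -/
theorem exists_bZero_quotient_of_invariant (H : Subgroup G) {f : Z.Fn} (hf : f ∈ Z.logMero)
    (hinv : ∀ h ∈ H, A.actFn h f = f) :
    ∃ b : A.bZero (Action.ofMulAction G (G ⧸ H)), b.1 ((1 : G) : G ⧸ H) = f := by
  have hwd : ∀ a b : G, (QuotientGroup.leftRel H) a b → A.actFn a f = A.actFn b f := by
    intro a b hab
    rw [QuotientGroup.leftRel_apply] at hab
    have h1 : A.actFn (a⁻¹ * b) f = f := hinv _ hab
    have h2 : A.actFn a (A.actFn (a⁻¹ * b) f) = A.actFn b f := by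
      rw [← MulAut.mul_apply, ← map_mul, mul_inv_cancel_left]
    rw [h1] at h2
    exact h2
  refine ⟨⟨fun q => Quotient.liftOn' q (fun g => A.actFn g f) hwd, fun q => ?_, fun g q => ?_⟩, ?_⟩
  · induction q using QuotientGroup.induction_on with
    | H g => exact A.act_mem_logMero g hf
  · induction q using QuotientGroup.induction_on with
    | H x =>
      rw [Action.ofMulAction_apply, MulAction.Quotient.smul_coe, smul_eq_mul]
      change A.actFn (g * x) f = A.actFn g (A.actFn x f)
      rw [map_mul, MulAut.mul_apply]
  · change A.actFn 1 f = f
    rw [map_one, MulAut.one_apply]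

/-- Likewise `Φ₀(G/H) = Div⁺(Z^log_∞)^H` on the nose: every `H`-invariant effective Cartier log-divisor is the
base-point value of an equivariant family on `G/H`. [cite: MochizukiEtTh2009, Def 3.3 p.73] -/
theorem exists_phiZero_quotient_of_invariant (H : Subgroup G) {d : Z.DIV} (hd : d ∈ Z.Divplus)
    (hinv : ∀ h ∈ H, A.actDIV h d = d) :
    ∃ φ : A.phiZero (Action.ofMulAction G (G ⧸ H)), φ.1 ((1 : G) : G ⧸ H) = d := by
  have hwd : ∀ a b : G, (QuotientGroup.leftRel H) a b → A.actDIV a d = A.actDIV b d := by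
    intro a b hab
    rw [QuotientGroup.leftRel_apply] at hab
    have h1 : A.actDIV (a⁻¹ * b) d = d := hinv _ hab
    have h2 : A.actDIV a (A.actDIV (a⁻¹ * b) d) = A.actDIV b d := by
      rw [← MulAut.mul_apply, ← map_mul, mul_inv_cancel_left]
    rw [h1] at h2
    exact h2
  refine ⟨⟨fun q => Quotient.liftOn' q (fun g => A.actDIV g d) hwd, fun q => ?_, fun g q => ?_⟩, ?_⟩
  · induction q using QuotientGroup.induction_on with
    | H g => exact ⟨A.act_mem_Div g hd.1, A.act_mem_DIVplus g hd.2⟩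
  · induction q using QuotientGroup.induction_on with
    | H x =>
      rw [Action.ofMulAction_apply, MulAction.Quotient.smul_coe, smul_eq_mul]
      change A.actDIV (g * x) d = A.actDIV g (A.actDIV x d)
      rw [map_mul, MulAut.mul_apply]
  · change A.actDIV 1 d = d
    rw [map_one, MulAut.one_apply]

end LogDivisorModel.GaloisAction

/-! ## The typed `DivisorMonoids.Prop34` (ii) fields at the assembled record -/

namespace DivisorMonoids

variable {Z : LogDivisorModel.{u}} {G : Type u} [Group G] (A : Z.GaloisAction G) (hZ : Z.CuspLaws)

/-- **Typed Prop. 3.4 (ii), first field** `Prop34.ker_div₀_le_F₀` PROVED at `ofGaloisAction A hZ`: a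
log-meromorphic family with trivial divisor is constant. [cite: MochizukiEtTh2009, Prop 3.4 p.74] -/
theorem prop34_ker_div₀_le_F₀ (Y : (Action (Type u) G)ᵒᵖ) (b : (ofGaloisAction A hZ).B₀.obj Y)
    (h : (ofGaloisAction A hZ).div₀ Y b = 1) : b ∈ (ofGaloisAction A hZ).F₀ Y :=
  A.mem_fZero_of_divZeroHom_eq_one Y.unop h

/-- **Typed Prop. 3.4 (ii), second field** `Prop34.mem_F₀_of_div₀_mem` PROVED at `ofGaloisAction A hZ`: a
log-meromorphic family with effective divisor is constant. [cite: MochizukiEtTh2009, Prop 3.4 p.74] -/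
theorem prop34_mem_F₀_of_div₀_mem (Y : (Action (Type u) G)ᵒᵖ) (b : (ofGaloisAction A hZ).B₀.obj Y)
    (x : (ofGaloisAction A hZ).Φ₀.obj Y) (h : (ofGaloisAction A hZ).div₀ Y b = Algebra.GrothendieckGroup.of x) :
    b ∈ (ofGaloisAction A hZ).F₀ Y :=
  A.mem_fZero_of_divZeroHom_eq_of Y.unop h

/-- **At the constructed Def. 3.3 (iii) data, `Prop34` IS its Prop. 3.4 (i) vocabulary clauses**: for ANY
[FrdI] vocabularies `V`, `V₀` the typed `DivisorMonoids.Prop34 V V₀` holds at `ofGaloisAction A hZ` iff the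
three (i)-clauses (perf-factorial, non-dilating, divisorial-on-`D₀`, as `V`/`V₀` read them) hold there — the
(ii)-clauses carry no residual. [cite: MochizukiEtTh2009, Prop 3.4 p.74] -/
theorem prop34_ofGaloisAction_iff (V : FrdIMonoidStub.{u}) (V₀ : FrdICatStub.{u + 1, u, u} (Action (Type u) G)) :
    (ofGaloisAction A hZ).Prop34 V V₀ ↔
      (∀ Y : (Action (Type u) G)ᵒᵖ, V.IsPerfFactorial ((ofGaloisAction A hZ).Φ₀.obj Y)) ∧
        (∀ (Y : (Action (Type u) G)ᵒᵖ) (f : Y ⟶ Y),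
          V.IsNonDilating ((ofGaloisAction A hZ).Φ₀.obj Y) ((ofGaloisAction A hZ).Φ₀.map f).hom) ∧
        V₀.IsDivisorialOn (ofGaloisAction A hZ).Φ₀ :=
  ⟨fun h => ⟨h.isPerfFactorial, h.isNonDilating, h.isDivisorialOn⟩,
    fun h => ⟨h.1, h.2.1, h.2.2, prop34_ker_div₀_le_F₀ A hZ, prop34_mem_F₀_of_div₀_mem A hZ⟩⟩

/-- In particular `Prop34` holds OUTRIGHT at `ofGaloisAction A hZ` for the all-`True` vocabularies (the
content-isolating instance of the schema, cf. `Discharge/Sec3Prop34Schema.lean`): a NON-toy positive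
instance of F-2490 whose (ii)-clauses are theorems derived from Prop. 3.2 (ii). [cite: MochizukiEtTh2009, Prop 3.4 p.74] -/
theorem prop34_ofGaloisAction_top :
    (ofGaloisAction A hZ).Prop34 ⟨fun _ _ => True, fun _ _ _ _ _ => True, fun _ _ => True, fun _ _ _ => True⟩
      ⟨fun _ => True, fun _ => True, fun _ => True⟩ :=
  (prop34_ofGaloisAction_iff A hZ _ _).2 ⟨fun _ => trivial, fun _ _ => trivial, trivial⟩

end DivisorMonoids

end Literature.AnabelianGeometry.EtaleTheta
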